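import Summits.BirchSwinnertonDyer.BirchSwinnertonDyer.Theorems.EisensteinPrimesX2GeneratorCountAtP
import Summits.BirchSwinnertonDyer.BirchSwinnertonDyer.Theorems.EisensteinPrimesX2SplitTorsionLocalKernelClass
import Summits.BirchSwinnertonDyer.Rank1Residual.X1.GeneratorCountTorsionRat
import Summits.BirchSwinnertonDyer.Rank1Residual.X2.TorsionForcesSplit
import Literature.NumberTheory.EllipticCurves.AnomalousOfRationalTorsionProofs
import Literature.NumberTheory.EllipticCurves.BSDConductorProofs
import HarnessLib

/-!
# Route T at the ÉTALE END of a type-A SPLIT multiplicative class, END-TO-END IN THE KERNEL: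
# `p ∣ #E(ℚ)_tors ∧ (p ∣ c_v on S) ∧ μ_an ≤ m ⇒ AlgebraicLambdaGE W p (#S + 1 − 2·v_p(#E(ℚ)_tors) − m)`
# (route `EisensteinPrimes`, line `mudescent`, stub `stub_lambdaCount_offLocus`, ALGEBRAIC conjunct;
# seat bsd-eis-lam-b g2, PROGRAMME PART 1b seat (5); composition of p469158 / p477235 / p479686)

HONEST FRAMING (cell `bsd-eis`; no tranche here proves BSD): THEOREMS ONLY — no definition, no named
fact, nothing asserted about any particular curve, closes nothing, moves no label. This is the
kernel form of Greenberg's Cor. 5.6 count `B = t₀ + a − 2δ` (X1R0-GAPMAP §14.1; b2b eisenstein-p2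
`routeT/README.md`) at the member where EVERY route-T closure of the type-A multiplicative row binds
(census of this seat, HOME STATUS 2026-08-26): the étale end `W₀`, `δ = 1` (rational `p`-torsion),
`a = 1` (split `p`; FORCED by `δ = 1`, tree `X2.TorsionForcesSplit`), `μ_an(W₀) = 0`.

* §1 (any number field) `exists_fixed_geomTorsion_of_dvd_torsionOrder`: `p ∣ #E(K)_tors` gives a
  non-zero `Γ_K`-fixed `P̃ ∈ E[p]` (Cauchy in the finite group `E(K)_tors`, `toGeomPoints`).
* §2 `X2.generatorCountGE_of_dvd_torsionOrder_of_dvd_localTamagawaNumber`: `p` odd multiplicative,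
  `p ∣ #E(ℚ)_tors`, `S` places `v ∤ p` with `p ∣ c_v(E)` ⇒ `GeneratorCountGE W p b` for
  `b + 2·v_p(#E(ℚ)_tors) ≤ #S + 1` — the socket (p477235) fed by the split local kernel class
  (p479686), eisenstein-p1's torsion datum `#E[p^∞]^{Γ_ℚ} ≤ p^{v_p(#E(ℚ)_tors)}` and the Kodaira–Néron
  Tamagawa witnesses (n1011 / eisenstein-p1, tree theorems). Named fact: Poitou–Tate over `ℚ` (`hPT`).
* §3 `X2.algebraicLambdaGE_of_dvd_torsionOrder_of_dvd_localTamagawaNumber`: + `μ_an ≤ m`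
  (`X2.AnalyticMuLE W p m`), Wuthrich Thm. 16 (`hWu`), modularity (`hpar`), Prop. 4.15 (ii) (`h415`)
  ⇒ **`AlgebraicLambdaGE W p (b − m)`** (p469158; `E[p]` is reducible because of the rational
  `p`-torsion); `…_of_isIsogenous`: delivered at any isogenous member (g0's transport).

Examples this makes kernel-shaped (b2b routeT census, N < 2·10⁴; per-pair data remain census inputs):
`1020g1@3` (`λ_an = 5`, `t₀ = 2` at layer 0 — the layer-`m` count `t_m = 4` needs the layer socket),
and at λ-excess 2 the 132 X2b classes whose layer-0 budget suffices.

References: [GreenbergLNM1716] §3 pp. 88, 91–93, §5 pp. 114–118 (proof of Cor. 5.6), p. 137;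
[SilvermanAEC2009] VII.3, VIII.7; [Wuthrich2014] Thm. 16; X1R0-GAPMAP §14.1.
-/

set_option autoImplicit false
-- `Summit.BirchSwinnertonDyer.BirchSwinnertonDyer.…`: the summit and its single sub-problem share a name (D-0017 layout).
set_option linter.dupNamespace false

noncomputable section

open scoped Classical

open Function Field NumberField IsDedekindDomain WeierstrassCurve
  Literature.NumberTheory.EllipticCurves Literature.NumberTheory.GaloisRepresentations
  Literature.NumberTheory.GaloisCohomology Summit.BirchSwinnertonDyer.Rank1Residual.GaloisImage
  Literature.NumberTheory.EllipticCurves.Rank1Residual Literature.NumberTheory.EllipticCurves.ModularForms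
  Summit.BirchSwinnertonDyer.Rank1Residual
  Summit.BirchSwinnertonDyer.Rank1Residual.X1.GeneratorCountSqueeze
  Summit.BirchSwinnertonDyer.Rank1Residual.X1.TamagawaSqueeze
  Summit.BirchSwinnertonDyer.Rank1Residual.Additive
  Summit.BirchSwinnertonDyer.BirchSwinnertonDyer.Theorems.EisensteinPrimesAlgebraicLambdaGEIsogeny
  Summit.BirchSwinnertonDyer.BirchSwinnertonDyer.Theorems.EisensteinPrimesAlgebraicLambdaGEBudget
  Summit.BirchSwinnertonDyer.BirchSwinnertonDyer.Theorems.EisensteinPrimesX2GeneratorCountAtP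
  Summit.BirchSwinnertonDyer.BirchSwinnertonDyer.Theorems.EisensteinPrimesX2SplitTorsionLocalKernelClass
open Literature.NumberTheory.GaloisRepresentations.DiscreteGaloisModule (unramifiedSubgroup)

namespace Summit.BirchSwinnertonDyer.BirchSwinnertonDyer.Theorems.EisensteinPrimesX2AlgebraicLambdaGESplitTorsion

/-! ## §1. A non-zero `Γ_K`-fixed point of `E[p]` from `p ∣ #E(K)_tors` -/

/-- **`p ∣ #E(K)_tors` gives a non-zero `Γ_K`-fixed point of `E[p] = E(K̄)[p]`**: Cauchy's theorem
in the finite group `E(K)_tors` (tree `finite_torsion_point`) and the inclusion `E(K) ↪ E(K̄)`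
(`toGeomPoints`, injective, `Γ_K`-fixed image). [cite: SilvermanAEC2009, §VIII.7 (p. 240) and VIII.§1] -/
theorem exists_fixed_geomTorsion_of_dvd_torsionOrder {K : Type} [Field K] [NumberField K]
    (V : WeierstrassCurve K) [V.IsElliptic] (p : ℕ) [hp : Fact p.Prime] (h : p ∣ V.torsionOrder) :
    ∃ Pt : geomTorsion V (p : ℤ), Pt ≠ 0 ∧ ∀ σ : absoluteGaloisGroup K, σ • Pt = Pt := by
  haveI := V.finite_torsion_point
  unfold WeierstrassCurve.torsionOrder at h
  obtain ⟨t, ht⟩ := exists_prime_addOrderOf_dvd_card' p h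
  have ht' : addOrderOf (t.1 : V.toAffine.Point) = p := (AddSubgroup.addOrderOf_coe t).trans ht
  set T : V.toAffine.Point := t.1 with hT
  have hpT : p • T = 0 := by rw [← ht']; exact addOrderOf_nsmul_eq_zero T
  have hT0 : T ≠ 0 := fun h0 ↦ by
    rw [h0, addOrderOf_zero] at ht'
    exact hp.out.one_lt.ne ht'
  have hpTg : p • toGeomPoints V T = 0 := by rw [← map_nsmul, hpT, map_zero]
  refine ⟨⟨toGeomPoints V T, AddSubgroup.torsionBy.nsmul_iff.mpr hpTg⟩, fun h0 ↦ hT0 ?_, fun σ ↦ ?_⟩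
  · exact toGeomPoints_injective V (by rw [map_zero]; exact congrArg Subtype.val h0)
  · exact Subtype.ext (by
      rw [Literature.NumberTheory.EllipticCurves.AddSubgroup.torsionBy.coe_smul]
      exact smul_toGeomPoints V σ T)

/-! ## §2. X2, `δ = 1`: the generator count at a split Eisenstein prime carrying rational `p`-torsion -/

section X2

variable {W : WeierstrassCurve ℚ} [W.IsElliptic] [W.IsGloballyMinimal] {p : ℕ} [hp : Fact p.Prime]

/-- **`GeneratorCountGE W p b` for `b + 2·v_p(#E(ℚ)_tors) ≤ #S + 1`** at an odd MULTIPLICATIVE prime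
`p` with `p ∣ #E(ℚ)_tors` (then `p` is split, `X2.TorsionForcesSplit`), `S` a finite set of places
`v ∤ p` with `p ∣ c_v(E)`. The socket `X2.generatorCountGE_of_localKernelClass_torsion_mult`
(p477235) fed by: the split local kernel class of a rational `p`-torsion point
(`X2.exists_localKernelClass_of_split_of_fixed_torsion`, p479686), the torsion datum
`#E[p^∞]^{Γ_ℚ} ≤ p^{v_p(#E(ℚ)_tors)}` (eisenstein-p1), and the Kodaira–Néron Tamagawa witnesses
(`p ∣ c_v` forces additive or split multiplicative `v`, either carrying an unramified non-Kummer
class). Named fact: Poitou–Tate duality over `ℚ` (`hPT`). This is `B = t₀ + 1 − 2δ`, `δ = v_p(#E(ℚ)_tors)`.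
[cite: GreenbergLNM1716, §3 pp. 88 and 91–93, §5 pp. 114–118, p. 137]
[cite: SilvermanATAEC1994, Cor. IV.9.2(d), IV.9.4 Step 2] -/
theorem X2.generatorCountGE_of_dvd_torsionOrder_of_dvd_localTamagawaNumber (hodd : p ≠ 2)
    (hPT : poitouTate_selmerStructure_duality ℚ) (hmult : W.HasMultiplicativeReductionAtPrime p)
    (htors : p ∣ W.torsionOrder) (S : Finset (HeightOneSpectrum (𝓞 ℚ)))
    (hSp : ∀ v ∈ S, ((p : ℕ) : 𝓞 ℚ) ∉ v.asIdeal)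
    (hcv : ∀ v ∈ S,
      p ∣ (W.baseChange (v.adicCompletion ℚ)).localTamagawaNumber (v.adicCompletionIntegers ℚ))
    {b : ℕ} (hb : b + 2 * (W.torsionOrder).factorization p ≤ S.card + 1) :
    GeneratorCountGE W p b := by
  have hp3 : 3 ≤ p := by
    have h2 := hp.out.two_le
    omega
  have hsplit : W.HasSplitMultiplicativeReductionAtPrime p :=
    X2.hasSplitMultiplicativeReductionAtPrime_of_dvd_torsionOrder W p hp3 hmult htors
  -- the place above `p`
  set vp : HeightOneSpectrum (𝓞 ℚ) := (Rat.HeightOneSpectrum.primesEquiv (R := 𝓞 ℚ)).symm ⟨p, hp.out⟩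
    with hvpdef
  have hvp : ((p : ℕ) : 𝓞 ℚ) ∈ vp.asIdeal :=
    (natCast_mem_asIdeal_iff_eq_primesEquiv_symm vp hp.out).mpr hvpdef
  -- the rational `p`-torsion, seen in `E[p]`, and its split local kernel class (p479686)
  obtain ⟨Pt, hPt0, hPt⟩ := exists_fixed_geomTorsion_of_dvd_torsionOrder W p htors
  refine X2.generatorCountGE_of_localKernelClass_torsion_mult hodd hPT hmult
    (X1.GeneratorCountTorsion.natCard_fixedPoints_le_pow_factorization_torsionOrder W p) S hSp
    (fun v hv ↦ ?_) vp hvp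
    (fun κ hκ ↦ X2.exists_localKernelClass_of_split_of_fixed_torsion hodd hsplit Pt hPt hPt0 vp hvp κ hκ)
    hb
  -- Tamagawa witnesses at `v ∈ S` (Kodaira–Néron; tree theorems)
  haveI : Finite (IsLocalRing.ResidueField (v.adicCompletionIntegers ℚ)) :=
    HeightOneSpectrum.finite_residueField_adicCompletionIntegers ℚ v
  rcases Additive.hasAdditiveReductionAt_or_hasSplitMultiplicativeReductionAt_of_dvd_localTamagawaNumber
      W v hodd (hcv v hv) with hadd | hspl
  · exact Additive.exists_mem_unramifiedSubgroup_not_mem_kummerLocalConditionAt_of_hasAdditiveReductionAt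
      W p v (hSp v hv) hodd hadd (hcv v hv)
  · exact Additive.exists_mem_unramifiedSubgroup_not_mem_kummerLocalConditionAt_of_split_of_dvd_localTamagawaNumber
      W v hspl (hSp v hv) (hcv v hv)

/-! ## §3. The λ-lower bound in the stub's currency -/

/-- **`AlgebraicLambdaGE W p (b − m)` for `b + 2·v_p(#E(ℚ)_tors) ≤ #S + 1` at a member with `μ_an ≤ m`**:
`W/ℚ` globally minimal, `p` odd multiplicative with `p ∣ #E(ℚ)_tors` (so split and `E[p]` reducible),
`S` places `v ∤ p` with `p ∣ c_v(E)`, the certificate `X2.AnalyticMuLE W p m`. §2's count through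
this seat's `X2.algebraicLambdaGE_of_generatorCountGE_of_analyticMuLE` (p469158: Greenberg's
inequality `#(X/𝔪X) ≤ p^{λ+μ}`, Prop. 4.15 (ii), Wuthrich Thm. 16 for `μ ≤ μ_an`). At the étale end
`W₀` of a type-A split class (`m = 0`, `v_p(#tors) = 1`, `b = #S − 1`) this is the binding route-T
certificate `λ(X(W₀/ℚ_∞)) ≥ t₀ + 1 − 2`, IN THE KERNEL modulo the named facts `hPT`, `h415`, `hWu`,
`hpar` and the per-pair integer data. [cite: GreenbergLNM1716, §5 pp. 114–118, p. 137, Prop. 4.15 (ii)]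
[cite: Wuthrich2014, Thm. 16 (p. 397)] -/
theorem X2.algebraicLambdaGE_of_dvd_torsionOrder_of_dvd_localTamagawaNumber (hodd : p ≠ 2)
    (hPT : poitouTate_selmerStructure_duality ℚ)
    (h415 : Greenberg1999.prop415ii_noFiniteSubmodule_of_ordinary_or_multiplicative)
    (hWu : Wuthrich2014.thm16_charIdeal_dvd_multiplicative_of_reducible)
    (hpar : nonempty_modularParametrizationData)
    (hmult : W.HasMultiplicativeReductionAtPrime p) (htors : p ∣ W.torsionOrder)
    (S : Finset (HeightOneSpectrum (𝓞 ℚ))) (hSp : ∀ v ∈ S, ((p : ℕ) : 𝓞 ℚ) ∉ v.asIdeal)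
    (hcv : ∀ v ∈ S,
      p ∣ (W.baseChange (v.adicCompletion ℚ)).localTamagawaNumber (v.adicCompletionIntegers ℚ))
    {m : ℕ} (hμ : X2.AnalyticMuLE W p m)
    {b : ℕ} (hb : b + 2 * (W.torsionOrder).factorization p ≤ S.card + 1) :
    AlgebraicLambdaGE W p (b - m) :=
  X2.algebraicLambdaGE_of_generatorCountGE_of_analyticMuLE hWu hpar h415 hodd hmult
    (not_hasIrreducibleModPGaloisRep_of_dvd_torsionOrder W p htors) hμ
    (X2.generatorCountGE_of_dvd_torsionOrder_of_dvd_localTamagawaNumber hodd hPT hmult htors S hSp hcv hb)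

/-- **The same bound delivered at ANY member of the isogeny class** (e.g. certified at the étale end
`W₀`, used at the displayed curve `W'`, or conversely): `AlgebraicLambdaGE` is an isogeny-class
invariant (g0's `algebraicLambdaGE_of_isIsogenous`, unconditional).
[cite: GreenbergVatsal2000, §2 p. 28] [cite: GreenbergLNM1716, §5 pp. 114–118, p. 137] -/
theorem X2.algebraicLambdaGE_of_isIsogenous_of_dvd_torsionOrder_of_dvd_localTamagawaNumber
    {W' : WeierstrassCurve ℚ} [W'.IsElliptic] [W'.IsGloballyMinimal] (hiso : IsIsogenous W' W)
    (hodd : p ≠ 2) (hPT : poitouTate_selmerStructure_duality ℚ)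
    (h415 : Greenberg1999.prop415ii_noFiniteSubmodule_of_ordinary_or_multiplicative)
    (hWu : Wuthrich2014.thm16_charIdeal_dvd_multiplicative_of_reducible)
    (hpar : nonempty_modularParametrizationData)
    (hmult : W.HasMultiplicativeReductionAtPrime p) (htors : p ∣ W.torsionOrder)
    (S : Finset (HeightOneSpectrum (𝓞 ℚ))) (hSp : ∀ v ∈ S, ((p : ℕ) : 𝓞 ℚ) ∉ v.asIdeal)
    (hcv : ∀ v ∈ S,
      p ∣ (W.baseChange (v.adicCompletion ℚ)).localTamagawaNumber (v.adicCompletionIntegers ℚ))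
    {m : ℕ} (hμ : X2.AnalyticMuLE W p m)
    {b : ℕ} (hb : b + 2 * (W.torsionOrder).factorization p ≤ S.card + 1) :
    AlgebraicLambdaGE W' p (b - m) :=
  algebraicLambdaGE_of_isIsogenous hiso
    (X2.algebraicLambdaGE_of_dvd_torsionOrder_of_dvd_localTamagawaNumber hodd hPT h415 hWu hpar hmult
      htors S hSp hcv hμ hb)

end X2

end Summit.BirchSwinnertonDyer.BirchSwinnertonDyer.Theorems.EisensteinPrimesX2AlgebraicLambdaGESplitTorsion

end
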